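import Summits.RiemannHypothesis.RiemannHypothesis.Theorems.WeilTwoPrimeDeflC83XBase
import Literature.NumberTheory.LFunctions.WeilBlockRows
import HarnessLib

/-!
# Deflated two-prime certificate C83X: rows 80–87 of the even check `D C = I`

`WeilCert.checkDCRow 0` for certificate C83X, by `decide +kernel`. Pure proof file.
-/

set_option linter.dupNamespace false

noncomputable section

namespace Summit.RiemannHypothesis.RiemannHypothesis.Theorems.EvenWinsBeyondArch

open Literature.NumberTheory.LFunctions

set_option maxHeartbeats 0 in
/-- Kernel check of row 80 of the even `D C = I` (certificate C83X). [folklore] -/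
theorem checkDCRow0_80_weilCertDeflC83X : weilCertDeflC83XBase.checkDCRow 0 80 = true := by
  decide +kernel

set_option maxHeartbeats 0 in
/-- Kernel check of row 81 of the even `D C = I` (certificate C83X). [folklore] -/
theorem checkDCRow0_81_weilCertDeflC83X : weilCertDeflC83XBase.checkDCRow 0 81 = true := by
  decide +kernel

set_option maxHeartbeats 0 in
/-- Kernel check of row 82 of the even `D C = I` (certificate C83X). [folklore] -/
theorem checkDCRow0_82_weilCertDeflC83X : weilCertDeflC83XBase.checkDCRow 0 82 = true := by
  decide +kernel

set_option maxHeartbeats 0 in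
/-- Kernel check of row 83 of the even `D C = I` (certificate C83X). [folklore] -/
theorem checkDCRow0_83_weilCertDeflC83X : weilCertDeflC83XBase.checkDCRow 0 83 = true := by
  decide +kernel

set_option maxHeartbeats 0 in
/-- Kernel check of row 84 of the even `D C = I` (certificate C83X). [folklore] -/
theorem checkDCRow0_84_weilCertDeflC83X : weilCertDeflC83XBase.checkDCRow 0 84 = true := by
  decide +kernel

set_option maxHeartbeats 0 in
/-- Kernel check of row 85 of the even `D C = I` (certificate C83X). [folklore] -/
theorem checkDCRow0_85_weilCertDeflC83X : weilCertDeflC83XBase.checkDCRow 0 85 = true := by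
  decide +kernel

set_option maxHeartbeats 0 in
/-- Kernel check of row 86 of the even `D C = I` (certificate C83X). [folklore] -/
theorem checkDCRow0_86_weilCertDeflC83X : weilCertDeflC83XBase.checkDCRow 0 86 = true := by
  decide +kernel

set_option maxHeartbeats 0 in
/-- Kernel check of row 87 of the even `D C = I` (certificate C83X). [folklore] -/
theorem checkDCRow0_87_weilCertDeflC83X : weilCertDeflC83XBase.checkDCRow 0 87 = true := by
  decide +kernel


end Summit.RiemannHypothesis.RiemannHypothesis.Theorems.EvenWinsBeyondArch
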